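import Summits.BirchSwinnertonDyer.BirchSwinnertonDyer.Theorems.GenusKolyvaginAtTwoGenusPrimitiveSupplyAtTwoTwistingPrimeLevelFourClassValues
import HarnessLib

/-!
# Route `GenusKolyvaginAtTwo`, crux #2 `GenusPrimitiveSupplyAtTwo` (stmt-BirchSwinnertonDyer-22136):
# THE EXACT LOCAL CRITERION FOR THE LEVEL-`4` CLASS AND THE EXACT ENTANGLEMENT CRITERION —
# `ξ_W` strict at `ℓ₀` ⟺ `Frob_{ℓ₀}² = ±1` on `E[4]`;  entangled ⟺ [`W` Selmer-entangled] ∧ [`Frob_{ℓ₀}² = ±1` on `E[4]`]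

Width seat `bsd-line-gk2-p4` g10, cell `bsd-f1-sign2`; helper (`--supports stmt-BirchSwinnertonDyer-22136`), §55 of the twisting-prime
series (after `…LevelFourClassValues` §54, `…LevelFourClassFrobenius` §52, `…EntangledCriterion` §48). THEOREMS ONLY: no definition,
no named fact beyond the displayed hypotheses, no `sorry`; no item is closed; BSD is not proved by this.

* §55a **`mem_strictLocalKer_iff_sq_smul`**: `W/ℚ` elliptic, `ρ̄_{W,2}`, `ρ_{W,4}` onto, `x ≠ 0` in `H¹(ℚ, E[2])` dying on `Γ_{ℚ(E[4])}`
  (THE level-`4` class); `ℓ ≠ 2` a good prime with an arithmetic Frobenius `γ` that is a transposition on `E[2]` (`γ² ∈ Γ_{ℚ(E[2])}`,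
  `γ` moves `E[2]` — automatic at the Heegner twisting primes of a `Δ < 0` curve). Then
  **`x ∈ ker(H¹(ℚ, E[2]) → H¹(ℚ_ℓ, E[2])) ⟺ γ²` acts on `E[4]` as `+1` or as `−1`** (gk2-p3's local criterion at a Frobenius not fixing
  `E[2]`, both halves, + §54c; the hypotheses are conjugation-invariant, so any prime above `ℓ` may carry `γ`).
* §55b **`forall_torsionFixing_four_smul_eq_iff_selmer_entangled_and_sq_smul`**: in the frame of the entanglement criterion §48
  (minimal prime Heegner twin `Wd`, `P`, `Q`) with such a `γ` at `ℓ₀ = −d_K` and `ρ̄_{W,2}`, `ρ_{W,4}` onto: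
  **ENTANGLED ⟺ (some non-zero class of `Sel₂(W)` dies on `Γ_{ℚ(E[4])}`) ∧ (`γ² = ±1` on `E[4]`)** — the first factor is a property
  of `W` alone (§49: local at `2N`), the second a Čebotarev class of `ℓ₀` in `ℚ(E[4])` (for `ℓ₀ ≡ 3 (4)` the sign `−1` cannot occur:
  residue degree `2`). Both factors are realised (§53: entangled twins exist for Selmer-entangled `W`; §50: non-entangled ones for all `W`).

References: [GrossLMS1991] §9 Prop. 9.6; [McCallumLMS1991] §3 (3); [MazurRubin2010] Def. 3.1, Prop. 3.3; [LawsonWuthrich2016] §3;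
[NeukirchANT1999] I §9 (9.4), II §9 (9.6); [SilvermanAEC2009] VII.4.1.
-/

set_option linter.dupNamespace false -- tree convention: `Summit.BirchSwinnertonDyer.BirchSwinnertonDyer.Theorems` (summit = sub-problem)
set_option autoImplicit false

noncomputable section

open scoped Classical Pointwise

namespace Summit.BirchSwinnertonDyer.BirchSwinnertonDyer.Theorems.GenusKolyTwistingPrime

open WeierstrassCurve NumberField IsDedekindDomain Field
open Literature.NumberTheory.GaloisRepresentations Literature.NumberTheory.EllipticCurves
open Literature.NumberTheory Matrix
open Rat.HeightOneSpectrum (primesEquiv)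

/-! ## §55a The exact local criterion -/

section Local

variable (W : WeierstrassCurve ℚ) [W.IsElliptic]

omit [W.IsElliptic] in
/-- `σ²` acting as `±1` on `E[4]` is invariant under conjugation. [folklore] -/
theorem sq_smul_conj_iff {n : ℤ} (γ δ : absoluteGaloisGroup ℚ) :
    ((∀ P : geomTorsion W n, ((δ * γ * δ⁻¹) * (δ * γ * δ⁻¹)) • P = P) ∨
        (∀ P : geomTorsion W n, ((δ * γ * δ⁻¹) * (δ * γ * δ⁻¹)) • P = -P)) ↔
      ((∀ P : geomTorsion W n, (γ * γ) • P = P) ∨ (∀ P : geomTorsion W n, (γ * γ) • P = -P)) := by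
  have heq : (δ * γ * δ⁻¹) * (δ * γ * δ⁻¹) = δ * (γ * γ) * δ⁻¹ := by group
  rw [heq]
  constructor
  · rintro (h | h)
    · left
      intro P
      have h1 := h (δ • P)
      rw [mul_smul, mul_smul, inv_smul_smul] at h1
      exact smul_left_cancel δ h1
    · right
      intro P
      have h1 := h (δ • P)
      rw [mul_smul, mul_smul, inv_smul_smul, ← smul_neg] at h1
      exact smul_left_cancel δ h1
  · rintro (h | h)
    · left
      intro P
      rw [mul_smul, mul_smul, h, smul_inv_smul]
    · right
      intro P
      rw [mul_smul, mul_smul, h, smul_neg, smul_inv_smul]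

/-- **THE EXACT LOCAL CRITERION FOR THE LEVEL-`4` CLASS.** `W/ℚ` elliptic with `ρ̄_{W,2}` and `ρ_{W,4}` onto; `x ≠ 0` in `H¹(ℚ, E[2])`
dying on `Γ_{ℚ(E[4])}`; `ℓ ≠ 2` a prime of good reduction (`v` its place, `𝔓₀` any prime above it, `γ` an arithmetic Frobenius at
`𝔓₀`) with `γ² ∈ Γ_{ℚ(E[2])}` and `γ ≠ 1` on `E[2]`. Then **`x ∈ MazurRubin2010.strictLocalKer W ℚ_ℓ 2 ⟺ γ² = +1 ∨ γ² = −1` on `E[4]`.**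
Proof: at the Frobenius `F = δγδ⁻¹` of the prime cut out by `ℚ̄ → ℚ̄_v`, `x_v = 0 ⟺ [x, F] ∈ (F − 1)E[2]` (gk2-p3
`…FrobeniusCriterion.mem_torsionLocalKer_iff_exists_h1Eval_eq_smul_sub`, `x` being unramified as inertia fixes `E[4]`)
`⟺ F² = ±1` on `E[4]` (§54c) `⟺ γ² = ±1`; and `ℚ_v ≃ ℚ_ℓ`. [cite: GrossLMS1991, §9 Prop. 9.6] [cite: McCallumLMS1991, §3 (3)]
[cite: LawsonWuthrich2016, §3] [cite: MazurRubin2010, Def. 3.1] -/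
theorem mem_strictLocalKer_iff_sq_smul (hsurj : W.HasSurjectiveModNGaloisRep 2) (hsurj4 : W.HasSurjectiveModNGaloisRep 4)
    {x : galH1Torsion W (2 : ℤ)} (hx0 : x ≠ 0) (hx : ∀ h ∈ torsionFixing W (4 : ℤ), h1Eval W (2 : ℤ) x h = 0)
    {ℓ : ℕ} [Fact ℓ.Prime] (hℓ2 : ℓ ≠ 2) {v : HeightOneSpectrum (𝓞 ℚ)} (hℓv : (ℓ : 𝓞 ℚ) ∈ v.asIdeal) (hW : W.HasGoodReductionAt v)
    {𝔓₀ : Ideal (absIntegers (𝓞 ℚ) ℚ)} (h𝔓₀ : 𝔓₀ ∈ v.primesAbove) {γ : absoluteGaloisGroup ℚ}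
    (hγ : IsArithFrobAt (𝓞 ℚ) γ 𝔓₀) (hγγ : γ * γ ∈ torsionFixing W (2 : ℤ)) (hγT : ∃ T : geomTorsion W (2 : ℤ), γ • T ≠ T) :
    x ∈ MazurRubin2010.strictLocalKer W ℚ_[ℓ] (2 : ℤ) ↔
      ((∀ P : geomTorsion W (4 : ℤ), (γ * γ) • P = P) ∨ (∀ P : geomTorsion W (4 : ℤ), (γ * γ) • P = -P)) := by
  classical
  have hℓ : ℓ.Prime := Fact.out
  have hvℓ : ((primesEquiv v : Nat.Primes) : ℕ) = ℓ := primesEquiv_eq hℓ hℓv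
  subst hvℓ
  letI : Algebra ℚ (v.adicCompletion ℚ) := inferInstance
  haveI : CharZero (v.adicCompletion ℚ) := Literature.NumberTheory.GaloisRepresentations.charZero_adicCompletion v
  have hvbad : v ∉ W.badPlaces (𝓞 ℚ) := fun h ↦ h hW
  have hℓ2' : ¬ ((primesEquiv v : Nat.Primes) : ℕ) ∣ 2 := fun h ↦
    hℓ2 ((Nat.prime_dvd_prime_iff_eq hℓ Nat.prime_two).mp h)
  have hℓ4 : ¬ ((primesEquiv v : Nat.Primes) : ℕ) ∣ 4 := fun h ↦
    hℓ2' (hℓ.dvd_of_dvd_pow (show ((primesEquiv v : Nat.Primes) : ℕ) ∣ 2 ^ 2 by simpa using h))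
  have h2v : ((2 : ℤ) : 𝓞 ℚ) ∉ v.asIdeal := by
    have h := natCast_not_mem_of_not_dvd hℓ hℓv hℓ2'
    rw [Nat.cast_ofNat] at h
    rw [Int.cast_ofNat]
    exact h
  have h4v : ((4 : ℤ) : 𝓞 ℚ) ∉ v.asIdeal := by
    have h := natCast_not_mem_of_not_dvd hℓ hℓv hℓ4
    rw [Nat.cast_ofNat] at h
    rw [Int.cast_ofNat]
    exact h
  -- the prime cut out by `ℚ̄ → ℚ̄_v` and the conjugate Frobenius there
  obtain ⟨𝔐, h𝔐⟩ := v.localPrimesAbove_nonempty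
  set 𝔓w := v.primeBelow (closureEmb (K := ℚ) (v.adicCompletion ℚ)) 𝔐 with h𝔓w_def
  have h𝔓w : 𝔓w ∈ v.primesAbove := v.primeBelow_mem_primesAbove h𝔐
  obtain ⟨δ, -, hF⟩ := HeightOneSpectrum.exists_isArithFrobAt_conj_of_mem_primesAbove_holds h𝔓₀ h𝔓w hγ
  have hFF : (δ * γ * δ⁻¹) * (δ * γ * δ⁻¹) ∈ torsionFixing W (2 : ℤ) := by
    have heq : (δ * γ * δ⁻¹) * (δ * γ * δ⁻¹) = δ * (γ * γ) * δ⁻¹ := by group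
    rw [heq]
    exact (torsionFixing_normal W _).conj_mem _ hγγ δ
  have hFT : ∃ T : geomTorsion W (2 : ℤ), (δ * γ * δ⁻¹) • T ≠ T := by
    obtain ⟨T, hT⟩ := hγT
    refine ⟨δ • T, fun h ↦ hT ?_⟩
    rw [mul_smul, mul_smul, inv_smul_smul] at h
    exact smul_left_cancel δ h
  -- inertia fixes `E[2]` and `E[4]`; `x` is unramified at `𝔓w`
  have hI : 𝔓w.inertia (absoluteGaloisGroup ℚ) ≤ torsionFixing W (2 : ℤ) := inertia_le_torsionFixing W hvbad h2v _ h𝔐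
  have hI4 : 𝔓w.inertia (absoluteGaloisGroup ℚ) ≤ torsionFixing W (4 : ℤ) := inertia_le_torsionFixing W hvbad h4v _ h𝔐
  have hxur : x ∈ unramifiedKer (geomTorsion W (2 : ℤ)) 𝔓w := by
    rw [← oneCocycleClass_reprCocycle W (2 : ℤ) x]
    refine (oneCocycleClass_mem_subgroupResKer_iff _ _).mpr ⟨0, fun τ ↦ ?_⟩
    rw [smul_zero, sub_zero]
    exact hx _ (hI4 τ.2)
  -- the chain of equivalences
  have hcrit := GenusExact.FrobeniusCriterion.mem_torsionLocalKer_iff_exists_h1Eval_eq_smul_sub W (2 : ℤ) h𝔐 hF hI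
    (isOpen_torsionFixing W two_ne_zero) (torsionPointsMap_bijective W (v.adicCompletion ℚ) (n := 2) two_ne_zero).2 hxur
  rw [strictLocalKer_eq_torsionLocalKer W, mem_torsionLocalKer_padic_iff W
      (RingEquivClass.toRingEquiv (Rat.HeightOneSpectrum.adicCompletion.padicEquiv (R := 𝓞 ℚ) v)) (2 : ℤ) x,
    hcrit, exists_h1Eval_eq_smul_sub_iff_sq_smul W hsurj hsurj4 hx0 hx hFF hFT, sq_smul_conj_iff]

end Local

/-! ## §55b The exact entanglement criterion -/

section Entangled

variable (W : WeierstrassCurve ℚ) [W.IsElliptic] [W.IsGloballyMinimal] {K : Type} [Field K] [NumberField K]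

/-- **THE EXACT ENTANGLEMENT CRITERION.** In the frame of §48 (`W/ℚ` globally minimal, `Δ_W < 0`; `K` imaginary quadratic, odd
`d_K = −ℓ`, Heegner for `N_W`, `2` split; `Wd` a model of `W^{(d_K)}` with `#Sel₂(Wd) = 2`; `P ∈ Wd(ℚ)` with a half `Q` no
`E[2]`-translate of which is rational), with `ρ̄_{W,2}`, `ρ_{W,4}` onto and an arithmetic Frobenius `γ` at (a prime above) `ℓ` that is a
transposition on `E[2]` (`γ² ∈ Γ_{ℚ(E[2])}`, `γ` moves `E[2]`): **`Γ_{ℚ(E[4])}` fixes `Q` (ENTANGLED) ⟺ (some non-zero class of `Sel₂(W)`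
dies on `Γ_{ℚ(E[4])}`) ∧ (`γ²` acts on `E[4]` as `+1` or as `−1`)** — §48 + §55a. The first factor is «`W` Selmer-entangled»
(`ξ_W ∈ Sel₂(W)`, local at `2N_W`, §49); the second is a Čebotarev class of `ℓ` in `ℚ(E[4])`.
[cite: MazurRubin2010, Def. 3.1, Prop. 3.3] [cite: GrossLMS1991, §9 Prop. 9.6] [cite: LawsonWuthrich2016, §3] -/
theorem forall_torsionFixing_four_smul_eq_iff_selmer_entangled_and_sq_smul
    (hsurj : W.HasSurjectiveModNGaloisRep 2) (hsurj4 : W.HasSurjectiveModNGaloisRep 4)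
    (hΔ : W.Δ < 0) (hK : IsImaginaryQuadratic K) (hodd : Odd (discr K))
    (hH : SatisfiesHeegnerHypothesis (W.conductorNorm ℤ) K) (h2K : ((Ideal.span {(2 : ℤ)}).primesOver (𝓞 K)).ncard = 2)
    {ℓ : ℕ} [Fact ℓ.Prime] (hd : discr K = -(ℓ : ℤ)) {Wd : WeierstrassCurve ℚ} [Wd.IsElliptic] {C : VariableChange ℚ}
    (hWd : C • W.quadraticTwist (discr K : ℚ) = Wd) (h2 : Nat.card (Wd.selmerGroup 2) = 2)
    (P : Wd.toAffine.Point) (Q : geomPoints Wd) (hQ : (2 : ℤ) • Q = toGeomPoints Wd P)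
    (hP : ∀ T ∈ geomTorsion Wd (2 : ℤ), Q - T ∉ MulAction.fixedPoints (absoluteGaloisGroup ℚ) (geomPoints Wd))
    {v : HeightOneSpectrum (𝓞 ℚ)} (hℓv : (ℓ : 𝓞 ℚ) ∈ v.asIdeal) {𝔓₀ : Ideal (absIntegers (𝓞 ℚ) ℚ)}
    (h𝔓₀ : 𝔓₀ ∈ v.primesAbove) {γ : absoluteGaloisGroup ℚ} (hγ : IsArithFrobAt (𝓞 ℚ) γ 𝔓₀)
    (hγγ : γ * γ ∈ torsionFixing W (2 : ℤ)) (hγT : ∃ T : geomTorsion W (2 : ℤ), γ • T ≠ T) :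
    (∀ h ∈ torsionFixing W (4 : ℤ), h • Q = Q) ↔
      (∃ y ∈ W.selmerGroup 2, y ≠ 0 ∧ ∀ h ∈ torsionFixing W (4 : ℤ), h1Eval W (2 : ℤ) y h = 0) ∧
        ((∀ P : geomTorsion W (4 : ℤ), (γ * γ) • P = P) ∨ (∀ P : geomTorsion W (4 : ℤ), (γ * γ) • P = -P)) := by
  rw [forall_torsionFixing_four_smul_eq_iff_exists_selmer W hΔ hK hodd hH h2K hd hWd h2 P Q hQ hP]
  have hℓ : ℓ.Prime := Fact.out
  obtain ⟨hℓ2, hℓN, -⟩ := GenusKolyTwin.prime_discr_facts W hK hodd hH hℓ hd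
  have hW : W.HasGoodReductionAt v := by
    by_contra h
    exact hℓN ((primesEquiv_eq hℓ hℓv) ▸ (W.dvd_conductorNorm_iff v).mpr h)
  constructor
  · rintro ⟨y, hyS, hy0, hyd, hystr⟩
    exact ⟨⟨y, hyS, hy0, hyd⟩, (mem_strictLocalKer_iff_sq_smul W hsurj hsurj4 hy0 hyd hℓ2 hℓv hW h𝔓₀ hγ hγγ hγT).mp hystr⟩
  · rintro ⟨⟨y, hyS, hy0, hyd⟩, hsq⟩
    exact ⟨y, hyS, hy0, hyd, (mem_strictLocalKer_iff_sq_smul W hsurj hsurj4 hy0 hyd hℓ2 hℓv hW h𝔓₀ hγ hγγ hγT).mpr hsq⟩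

/-- **Corollary: at a twisting prime whose Frobenius (a transposition on `E[2]`) does NOT square to `±1` on `E[4]`, NO twin is
entangled** — whatever `W` (complements §53). [cite: MazurRubin2010, Prop. 3.3] [cite: LawsonWuthrich2016, §3] -/
theorem exists_torsionFixing_four_smul_ne_of_not_sq_smul
    (hsurj : W.HasSurjectiveModNGaloisRep 2) (hsurj4 : W.HasSurjectiveModNGaloisRep 4)
    (hΔ : W.Δ < 0) (hK : IsImaginaryQuadratic K) (hodd : Odd (discr K))
    (hH : SatisfiesHeegnerHypothesis (W.conductorNorm ℤ) K) (h2K : ((Ideal.span {(2 : ℤ)}).primesOver (𝓞 K)).ncard = 2)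
    {ℓ : ℕ} [Fact ℓ.Prime] (hd : discr K = -(ℓ : ℤ)) {Wd : WeierstrassCurve ℚ} [Wd.IsElliptic] {C : VariableChange ℚ}
    (hWd : C • W.quadraticTwist (discr K : ℚ) = Wd) (h2 : Nat.card (Wd.selmerGroup 2) = 2)
    (P : Wd.toAffine.Point) (Q : geomPoints Wd) (hQ : (2 : ℤ) • Q = toGeomPoints Wd P)
    (hP : ∀ T ∈ geomTorsion Wd (2 : ℤ), Q - T ∉ MulAction.fixedPoints (absoluteGaloisGroup ℚ) (geomPoints Wd))
    {v : HeightOneSpectrum (𝓞 ℚ)} (hℓv : (ℓ : 𝓞 ℚ) ∈ v.asIdeal) {𝔓₀ : Ideal (absIntegers (𝓞 ℚ) ℚ)}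
    (h𝔓₀ : 𝔓₀ ∈ v.primesAbove) {γ : absoluteGaloisGroup ℚ} (hγ : IsArithFrobAt (𝓞 ℚ) γ 𝔓₀)
    (hγγ : γ * γ ∈ torsionFixing W (2 : ℤ)) (hγT : ∃ T : geomTorsion W (2 : ℤ), γ • T ≠ T)
    (h1 : ∃ P : geomTorsion W (4 : ℤ), (γ * γ) • P ≠ P) (hm1 : ∃ P : geomTorsion W (4 : ℤ), (γ * γ) • P ≠ -P) :
    ∃ h ∈ torsionFixing W (4 : ℤ), h • Q ≠ Q := by
  by_contra hcon
  push Not at hcon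
  obtain ⟨-, hsq⟩ := (forall_torsionFixing_four_smul_eq_iff_selmer_entangled_and_sq_smul W hsurj hsurj4 hΔ hK hodd hH h2K hd
    hWd h2 P Q hQ hP hℓv h𝔓₀ hγ hγγ hγT).mp hcon
  rcases hsq with h | h
  · obtain ⟨P₁, hP₁⟩ := h1; exact hP₁ (h P₁)
  · obtain ⟨P₁, hP₁⟩ := hm1; exact hP₁ (h P₁)

end Entangled

end Summit.BirchSwinnertonDyer.BirchSwinnertonDyer.Theorems.GenusKolyTwistingPrime

end
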